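import Summits.BirchSwinnertonDyer.BirchSwinnertonDyer.Theorems.GenusKolyvaginAtTwoTorsionCellD0PairTwistSymbols
import HarnessLib

/-!
# SEL (iso-class Selmer pair law), I: the symbol configuration of an iso-class set of full-admissible primes

Crux R″ `RankOneTwoTorsionResidualAtTwo` (stmt-27478), LINE 49 «full_vertex», SUPPORT stub SEL
`IsoClassSelmerPairLawAtTwo` (`#Sel⁽²⁾(E₀^{(M₀)}) = 4·#ker Φ₃(Ĝ)`, `#Sel⁽²⁾(E₀^{(−p₀M₀)}) = 8·#ker Φ₃(B)` for an ISO-CLASS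
set `Q₀` of full-admissible primes of any even size; pen bsd-idea-1 memo #3 = the proof plan).  This first file of the
SEL series is curve-free: the `𝔽₂`-bookkeeping of the symbols of a finite set `Q` of primes `≡ 3 (mod 4)` that all lie
in ONE square class at every prime of a finite set `S` (pairwise: `q ≡ q' (mod 8)` and `(qq'/ℓ) = 1` for odd `ℓ ∈ S`).

Notation (all inline, no definition is introduced): for `j, i ∈ Q` the TOURNAMENT bit
`G j i := [−i/j] = (if jacobiSym (−i) j = −1 then 1 else 0) ∈ 𝔽₂` (the body of LINE 49's `legendreBit (−i) j`), the
row sum `g j := Σ_{i ∈ Q∖j} G j i`, so that the line's Rédei–Laplacian is `Ĝ = G + diag(g)`.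

* §1 `jacobiBit_add_jacobiBit_eq_one` — reciprocity between primes `≡ 3 (mod 4)`: `G j i + G i j = 1` (`i ≠ j`);
  `sum_col_eq_one_add_rowSum` — for `#Q` even the column sums are `1 + g`; hence
  `sum_laplacian_apply_eq_sum` — `𝟙ᵀ Ĝ m = 𝟙ᵀ m` for every `m : ℕ → 𝔽₂` (the evenness engine of the law).
* §2 the residue bit `qr_j` (tree `qrBit`) at a row prime `j ∈ Q` of the integers entering the descent:
  `qrBit_natCast_prime_eq_one_add` (`qr_j(i) = 1 + G j i`), `qrBit_prod_natCast_eq` (`qr_j(∏_{i∈m} i) = #(m∖j) + Σ_{i∈m∖j} G j i`).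
* §3 ISO-CLASS consequences: `qrBit_kernel_eq_of_isoClass` (the residue bit at `q ∈ Q` of an `S`-supported square-free
  kernel does not depend on `q`), `qrBit_natCast_eq_of_isoClass` (`qr_ℓ(q) = qr_ℓ(q')` at `ℓ ∈ S` odd),
  `isSquare_prod_adicCompletion_of_isoClass` (an EVEN sub-product `∏_{i∈m} i` is a square in `ℚ_v` for every `v ∈ S`).

Everything is proved; no LINE 49 statement is restated; BSD is not advanced by this file alone.

## References

* [HeathBrown1994SelmerCongruentII] D. R. Heath-Brown, Invent. Math. 118 (1994), §2 (Legendre-symbol matrices over `𝔽₂`).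
* [Kane2013SelmerTwists] D. M. Kane, Algebra Number Theory 7 (2013), §2.
* [SilvermanAEC2009] J. H. Silverman, *The Arithmetic of Elliptic Curves*, 2nd ed., Prop. X.1.4.
-/

noncomputable section

open scoped Classical

namespace Summit.BirchSwinnertonDyer.BirchSwinnertonDyer.Theorems.GenusKolyvaginAtTwo.TorsionCellSEL

open Literature.NumberTheory.EllipticCurves
open Literature.NumberTheory.EllipticCurves.TwoDescentLocal
open Literature.NumberTheory.EllipticCurves.KramerTwoDescent
open Summit.BirchSwinnertonDyer.BirchSwinnertonDyer.Theorems.GenusKolyvaginAtTwo.TorsionCellD0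
open IsDedekindDomain NumberField Rat.HeightOneSpectrum

/-! ## §1 The tournament of symbols and its Laplacian over `𝔽₂` -/

section Tournament

/-- **Reciprocity between two distinct primes `≡ 3 (mod 4)`**: exactly one of `[−i/j]`, `[−j/i]` is `1`
(`(−i/j)(−j/i) = (−1/j)(−1/i)(i/j)(j/i) = (−1)(−1)(−1) = −1`). [cite: HeathBrown1994SelmerCongruentII, §2] -/
theorem jacobiBit_add_jacobiBit_eq_one {i j : ℕ} (hi : i.Prime) (hj : j.Prime) (hne : i ≠ j) (hi4 : i % 4 = 3)
    (hj4 : j % 4 = 3) :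
    (if jacobiSym (-(i : ℤ)) j = -1 then (1 : ZMod 2) else 0) + (if jacobiSym (-(j : ℤ)) i = -1 then (1 : ZMod 2) else 0)
      = 1 := by
  have hoddi : Odd i := Nat.odd_iff.mpr (by omega)
  have hoddj : Odd j := Nat.odd_iff.mpr (by omega)
  have hcop : (j : ℤ).gcd i = 1 := by
    rw [Int.gcd_natCast_natCast]
    exact (Nat.coprime_primes hj hi).mpr hne.symm
  have e₁ : jacobiSym (-(i : ℤ)) j = - jacobiSym (i : ℤ) j := by
    rw [neg_eq_neg_one_mul, jacobiSym.mul_left, jacobiSym.at_neg_one hoddj, ZMod.χ₄_nat_three_mod_four hj4]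
    ring
  have e₂ : jacobiSym (-(j : ℤ)) i = - jacobiSym (j : ℤ) i := by
    rw [neg_eq_neg_one_mul, jacobiSym.mul_left, jacobiSym.at_neg_one hoddi, ZMod.χ₄_nat_three_mod_four hi4]
    ring
  have qr : jacobiSym (i : ℤ) j = - jacobiSym (j : ℤ) i := jacobiSym.quadratic_reciprocity_three_mod_four hi4 hj4
  rcases jacobiSym.eq_one_or_neg_one hcop with h | h <;>
    simp [e₁, e₂, qr, h]

variable (Q : Finset ℕ) (hQ : ∀ q ∈ Q, q.Prime) (hQ4 : ∀ q ∈ Q, q % 4 = 3)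
include hQ hQ4

/-- **Column sums of the tournament**: for `#Q` even and `i ∈ Q`, `Σ_{j ≠ i} [−i/j] = 1 + Σ_{j ≠ i} [−j/i]`
(there are `#Q − 1 ≡ 1` pairs `{i, j}`, each contributing `1`). [cite: HeathBrown1994SelmerCongruentII, §2] -/
theorem sum_col_eq_one_add_rowSum (hk : Even Q.card) {i : ℕ} (hi : i ∈ Q) :
    (∑ j ∈ Q.erase i, (if jacobiSym (-(i : ℤ)) j = -1 then (1 : ZMod 2) else 0)) =
      1 + ∑ j ∈ Q.erase i, (if jacobiSym (-(j : ℤ)) i = -1 then (1 : ZMod 2) else 0) := by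
  have hsum : (∑ j ∈ Q.erase i, ((if jacobiSym (-(i : ℤ)) j = -1 then (1 : ZMod 2) else 0) +
      (if jacobiSym (-(j : ℤ)) i = -1 then (1 : ZMod 2) else 0))) = ∑ j ∈ Q.erase i, (1 : ZMod 2) := by
    refine Finset.sum_congr rfl fun j hj => ?_
    have hji : j ≠ i := Finset.ne_of_mem_erase hj
    exact jacobiBit_add_jacobiBit_eq_one (hQ i hi) (hQ j (Finset.mem_of_mem_erase hj)) hji.symm (hQ4 i hi)
      (hQ4 j (Finset.mem_of_mem_erase hj))
  rw [Finset.sum_add_distrib, Finset.sum_const, Finset.card_erase_of_mem hi, nsmul_eq_mul, mul_one] at hsum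
  have hodd : ((Q.card - 1 : ℕ) : ZMod 2) = 1 := by
    obtain ⟨r, hr⟩ := hk
    have hpos : 0 < Q.card := Finset.card_pos.mpr ⟨i, hi⟩
    have : Q.card - 1 = 2 * (r - 1) + 1 := by omega
    rw [this, Nat.cast_add, Nat.cast_mul, show ((2 : ℕ) : ZMod 2) = 0 by decide, zero_mul, zero_add, Nat.cast_one]
  rw [hodd] at hsum
  -- `a + b = 1 ⟹ a = 1 + b` in `𝔽₂`
  set a := ∑ j ∈ Q.erase i, (if jacobiSym (-(i : ℤ)) j = -1 then (1 : ZMod 2) else 0)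
  set b := ∑ j ∈ Q.erase i, (if jacobiSym (-(j : ℤ)) i = -1 then (1 : ZMod 2) else 0)
  calc a = a + (b + b) := by rw [CharTwo.add_self_eq_zero, add_zero]
    _ = (a + b) + b := by rw [add_assoc]
    _ = 1 + b := by rw [hsum]

/-- **`𝟙ᵀ Ĝ = 𝟙ᵀ`**: for `#Q` even and any `m : ℕ → 𝔽₂`,
`Σ_{j∈Q} ( Σ_{i∈Q∖j} [−i/j]·m i + g_j·m j ) = Σ_{j∈Q} m j`, `g_j = Σ_{i∈Q∖j} [−i/j]` (exchange the double sum and use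
the column sums `1 + g`). This identity is what forces the `Q`-supports of the two components of a Selmer class of the
twist to have EVEN size. [cite: HeathBrown1994SelmerCongruentII, §2] [cite: Kane2013SelmerTwists, §2] -/
theorem sum_laplacian_apply_eq_sum (hk : Even Q.card) (m : ℕ → ZMod 2) :
    (∑ j ∈ Q, ((∑ i ∈ Q.erase j, (if jacobiSym (-(i : ℤ)) j = -1 then (1 : ZMod 2) else 0) * m i) +
        (∑ i ∈ Q.erase j, (if jacobiSym (-(i : ℤ)) j = -1 then (1 : ZMod 2) else 0)) * m j)) = ∑ j ∈ Q, m j := by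
  rw [Finset.sum_add_distrib]
  -- exchange the double sum: `Σ_j Σ_{i≠j} G j i m i = Σ_i m i Σ_{j≠i} G j i = Σ_i m i (1 + g i)`
  have hswap : (∑ j ∈ Q, ∑ i ∈ Q.erase j, (if jacobiSym (-(i : ℤ)) j = -1 then (1 : ZMod 2) else 0) * m i) =
      ∑ i ∈ Q, (∑ j ∈ Q.erase i, (if jacobiSym (-(i : ℤ)) j = -1 then (1 : ZMod 2) else 0)) * m i := by
    have key : (∑ j ∈ Q, ∑ i ∈ Q.erase j, (if jacobiSym (-(i : ℤ)) j = -1 then (1 : ZMod 2) else 0) * m i) =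
        ∑ j ∈ Q, ∑ i ∈ Q, (if i = j then 0 else (if jacobiSym (-(i : ℤ)) j = -1 then (1 : ZMod 2) else 0) * m i) := by
      refine Finset.sum_congr rfl fun j hj => ?_
      rw [← Finset.sum_erase_add _ _ hj, if_pos rfl, add_zero]
      exact Finset.sum_congr rfl fun i hi => by rw [if_neg (Finset.ne_of_mem_erase hi)]
    rw [key, Finset.sum_comm]
    refine Finset.sum_congr rfl fun i hi => ?_
    rw [← Finset.sum_erase_add _ _ hi, if_pos rfl, add_zero, Finset.sum_mul]
    exact Finset.sum_congr rfl fun j hj => by rw [if_neg (Finset.ne_of_mem_erase hj).symm]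
  rw [hswap, ← Finset.sum_add_distrib]
  refine Finset.sum_congr rfl fun i hi => ?_
  rw [sum_col_eq_one_add_rowSum Q hQ hQ4 hk hi, add_mul, one_mul, add_assoc, CharTwo.add_self_eq_zero, add_zero]

end Tournament

/-! ## §2 Residue bits at a row prime `j ∈ Q` -/

section Row

variable {j : ℕ} [hj : Fact j.Prime]

/-- `qr_j(−i) = [−i/j]` for a prime `i ≠ j` (tree `qrBit` vs. the Jacobi symbol). [cite: SilvermanAEC2009, Prop. X.1.4] -/
theorem qrBit_neg_natCast_prime_eq {i : ℕ} (hi : i.Prime) (hij : i ≠ j) :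
    qrBit j (-(i : ℚ)) = (if jacobiSym (-(i : ℤ)) j = -1 then (1 : ZMod 2) else 0) := by
  have hnd : ¬ (j : ℤ) ∣ -(i : ℤ) := by
    rw [Int.dvd_neg]; intro hd
    exact hij ((Nat.prime_dvd_prime_iff_eq hj.out hi).mp (by exact_mod_cast hd)).symm
  have h := qrBit_intCast (p := j) hnd
  rw [jacobiSym.legendreSym.to_jacobiSym] at h
  exact_mod_cast h

/-- `qr_j(i) = 1 + [−i/j]` for primes `i ≠ j`, `j ≡ 3 (mod 4)` (`qr_j(−1) = 1`). [cite: SilvermanAEC2009, Prop. X.1.4] -/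
theorem qrBit_natCast_prime_eq_one_add (hj4 : j % 4 = 3) {i : ℕ} (hi : i.Prime) (hij : i ≠ j) :
    qrBit j (i : ℚ) = 1 + (if jacobiSym (-(i : ℤ)) j = -1 then (1 : ZMod 2) else 0) := by
  have hi0 : (i : ℚ) ≠ 0 := by exact_mod_cast hi.ne_zero
  rw [← qrBit_neg_natCast_prime_eq hi hij, qrBit_neg (p := j) hi0, qrBit_neg_one_eq_one_of_emod_four hj4, ← add_assoc,
    CharTwo.add_self_eq_zero, zero_add]

/-- **`qr_j` of a sub-product**: for `m ⊆ Q` (primes `≡ 3 (mod 4)`, `j ∈ Q`),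
`qr_j(∏_{i∈m} i) = #(m∖j) + Σ_{i ∈ m∖j} [−i/j]` (the factor `j`, if present, is dropped by `qr_j(j·r) = qr_j(r)`).
[cite: SilvermanAEC2009, Prop. X.1.4] [cite: HeathBrown1994SelmerCongruentII, §2] -/
theorem qrBit_prod_natCast_eq (Q : Finset ℕ) (hQ : ∀ q ∈ Q, q.Prime) (hj4 : j % 4 = 3)
    {m : Finset ℕ} (hm : m ⊆ Q) :
    qrBit j (∏ i ∈ m, (i : ℚ)) =
      ((m.erase j).card : ZMod 2) + ∑ i ∈ m.erase j, (if jacobiSym (-(i : ℤ)) j = -1 then (1 : ZMod 2) else 0) := by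
  have hm0 : ∀ i ∈ m.erase j, (i : ℚ) ≠ 0 := fun i hi => by
    exact_mod_cast (hQ i (hm (Finset.mem_of_mem_erase hi))).ne_zero
  have hstep : qrBit j (∏ i ∈ m, (i : ℚ)) = qrBit j (∏ i ∈ m.erase j, (i : ℚ)) := by
    by_cases hjm : j ∈ m
    · rw [← Finset.mul_prod_erase m (fun i => (i : ℚ)) hjm, qrBit_natCast_mul]
    · rw [Finset.erase_eq_of_notMem hjm]
  rw [hstep, qrBit_prod_natCast (m.erase j) (fun i hi => (hQ i (hm (Finset.mem_of_mem_erase hi))).ne_zero),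
    Finset.card_eq_sum_ones, Nat.cast_sum, ← Finset.sum_add_distrib]
  refine Finset.sum_congr rfl fun i hi => ?_
  rw [Nat.cast_one, qrBit_natCast_prime_eq_one_add hj4 (hQ i (hm (Finset.mem_of_mem_erase hi))) (Finset.ne_of_mem_erase hi)]

end Row

/-! ## §3 The iso-class: one square class at every prime of `S` -/

section IsoClass

variable (S Q : Finset ℕ) (hS : ∀ ℓ ∈ S, ℓ.Prime) (hQ : ∀ q ∈ Q, q.Prime) (hQS : ∀ q ∈ Q, q ∉ S)
  (hQ4 : ∀ q ∈ Q, q % 4 = 3) (hiso8 : ∀ q ∈ Q, ∀ q' ∈ Q, q % 8 = q' % 8)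
  (hisoS : ∀ q ∈ Q, ∀ q' ∈ Q, ∀ ℓ ∈ S, (hℓ : ℓ.Prime) → ℓ ≠ 2 → haveI : Fact ℓ.Prime := ⟨hℓ⟩;
    legendreSym ℓ ((q : ℤ) * q') = 1)
include hS hQ hQS hQ4 hiso8 hisoS

omit hQ in
/-- **The residue bit at `q ∈ Q` of an `S`-supported square-free kernel `ε ∏_{ℓ∈T} ℓ` (`T ⊆ S`, `ε = ±1`) does not
depend on `q`** (reciprocity: `(ℓ/q) = (−q/ℓ)` for `q ≡ 3 (mod 4)`, `(2/q)` depends on `q mod 8`, `(−1/q) = −1`).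
[cite: HeathBrown1994SelmerCongruentII, §2] [cite: Kane2013SelmerTwists, §2] -/
theorem qrBit_kernel_eq_of_isoClass {q q' : ℕ} [Fact q.Prime] [Fact q'.Prime] (hq : q ∈ Q) (hq' : q' ∈ Q)
    {T : Finset ℕ} (hT : T ⊆ S) {ε : ℚ} (hε : ε = 1 ∨ ε = -1) :
    qrBit q (ε * ∏ ℓ ∈ T, (ℓ : ℚ)) = qrBit q' (ε * ∏ ℓ ∈ T, (ℓ : ℚ)) := by
  have hε0 : ε ≠ 0 := by rcases hε with h | h <;> rw [h] <;> norm_num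
  have hT0 : ∀ ℓ ∈ T, (ℓ : ℚ) ≠ 0 := fun ℓ hℓ => by exact_mod_cast (hS ℓ (hT hℓ)).ne_zero
  have hprod0 : ∏ ℓ ∈ T, (ℓ : ℚ) ≠ 0 := Finset.prod_ne_zero_iff.mpr hT0
  rw [qrBit_mul q hε0 hprod0, qrBit_mul q' hε0 hprod0, qrBit_prod q T _ hT0, qrBit_prod q' T _ hT0]
  have hεeq : qrBit q ε = qrBit q' ε := by
    rcases hε with h | h
    · rw [h, qrBit_one, qrBit_one]
    · rw [h, qrBit_neg_one_eq_one_of_emod_four (hQ4 q hq), qrBit_neg_one_eq_one_of_emod_four (hQ4 q' hq')]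
  rw [hεeq]
  congr 1
  refine Finset.sum_congr rfl fun ℓ hℓ => ?_
  have hℓS := hT hℓ
  by_cases hℓ2 : ℓ = 2
  · subst hℓ2
    have h8 : ((q : ℤ) * q') % 8 = 1 := by
      have h1 : q % 8 = 3 ∨ q % 8 = 7 := by have := hQ4 q hq; omega
      have h2 := hiso8 q hq q' hq'
      have : ((q : ℤ) * q') % 8 = ((q % 8 : ℕ) * (q' % 8 : ℕ) : ℤ) % 8 := by push_cast; rw [Int.mul_emod]
      rw [this, ← h2]; rcases h1 with h1 | h1 <;> rw [h1] <;> norm_num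
    exact_mod_cast qrBit_two_eq_qrBit_two_of_mul_emod_eight (hQ4 q hq) (hQ4 q' hq') h8
  · exact qrBit_eq_qrBit_of_legendreSym_mul_eq_one (hQ4 q hq) (hQ4 q' hq') (hS ℓ hℓS) hℓ2
      (fun h => hQS q hq (h ▸ hℓS)) (fun h => hQS q' hq' (h ▸ hℓS)) (hisoS q hq q' hq' ℓ hℓS (hS ℓ hℓS) hℓ2)

omit hS hQS hQ4 hiso8 in
/-- **At an odd `ℓ ∈ S` all `q ∈ Q` have the same residue bit**: `qr_ℓ(q) = qr_ℓ(q')` (from `(qq'/ℓ) = 1`).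
[cite: Kane2013SelmerTwists, §2] -/
theorem qrBit_natCast_eq_of_isoClass {ℓ : ℕ} [hℓ : Fact ℓ.Prime] (hℓS : ℓ ∈ S) (hℓ2 : ℓ ≠ 2) {q q' : ℕ} (hq : q ∈ Q)
    (hq' : q' ∈ Q) : qrBit ℓ (q : ℚ) = qrBit ℓ (q' : ℚ) := by
  have hq0 : (q : ℚ) ≠ 0 := by exact_mod_cast (hQ q hq).ne_zero
  have hq0' : (q' : ℚ) ≠ 0 := by exact_mod_cast (hQ q' hq').ne_zero
  have hmul : qrBit ℓ ((q : ℚ) * q') = 0 := by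
    have hj : jacobiSym ((q : ℤ) * q') ℓ = 1 := by
      rw [← jacobiSym.legendreSym.to_jacobiSym]; exact hisoS q hq q' hq' ℓ hℓS hℓ.out hℓ2
    have h := qrBit_intCast_of_jacobiSym_eq_one (p := ℓ) hj
    exact_mod_cast h
  rw [qrBit_mul ℓ hq0 hq0'] at hmul
  -- `a + b = 0 ⟹ a = b` in `𝔽₂`
  calc qrBit ℓ (q : ℚ) = qrBit ℓ (q : ℚ) + (qrBit ℓ (q' : ℚ) + qrBit ℓ (q' : ℚ)) := by
        rw [CharTwo.add_self_eq_zero, add_zero]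
    _ = (qrBit ℓ (q : ℚ) + qrBit ℓ (q' : ℚ)) + qrBit ℓ (q' : ℚ) := by rw [add_assoc]
    _ = qrBit ℓ (q' : ℚ) := by rw [hmul, zero_add]

omit hS in
/-- **An even sub-product of an iso-class set is a square in `ℚ_v` for every `v ∈ S`** (odd `ℓ ∈ S`: an `ℓ`-unit whose
residue bit is `#m · qr_ℓ(q₀) = 0`; `ℓ = 2`: `∏ i ≡ r^{#m} ≡ 1 (mod 8)`). [cite: Kane2013SelmerTwists, §2]
[cite: SilvermanAEC2009, Prop. X.1.4] -/
theorem isSquare_prod_adicCompletion_of_isoClass {m : Finset ℕ} (hm : m ⊆ Q) (hmk : Even m.card)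
    (v : HeightOneSpectrum (𝓞 ℚ)) (hv : (primesEquiv v : ℕ) ∈ S) :
    IsSquare (algebraMap ℚ (v.adicCompletion ℚ) (∏ i ∈ m, (i : ℚ))) := by
  have hm0 : ∀ i ∈ m, (i : ℚ) ≠ 0 := fun i hi => by exact_mod_cast (hQ i (hm hi)).ne_zero
  have hprod0 : ∏ i ∈ m, (i : ℚ) ≠ 0 := Finset.prod_ne_zero_iff.mpr hm0
  haveI hℓ : Fact (primesEquiv v : ℕ).Prime := ⟨(primesEquiv v).2⟩
  -- the valuation at `ℓ = primesEquiv v ∈ S` vanishes (`ℓ ∉ m ⊆ Q`)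
  have hmQ : ∀ i ∈ m, i.Prime := fun i hi => hQ i (hm hi)
  have hℓm : (primesEquiv v : ℕ) ∉ m := fun h => hQS _ (hm h) hv
  have hval : padicValRat (primesEquiv v : ℕ) (∏ i ∈ m, (i : ℚ)) = 0 := by
    rw [padicValRat_prod_primes hmQ, if_neg hℓm]
  by_cases hme : m = ∅
  · subst hme
    rw [Finset.prod_empty, map_one]
    exact ⟨1, (mul_one 1).symm⟩
  obtain ⟨i₀, hi₀⟩ := Finset.nonempty_iff_ne_empty.mpr hme
  obtain ⟨s, hs⟩ := hmk
  by_cases hℓ2 : (primesEquiv v : ℕ) = 2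
  · -- the place above `2`: `∏ i ≡ i₀^{#m} ≡ 1 (mod 8)`
    have hodd : ¬ (2 : ℤ) ∣ ∏ i ∈ m, (i : ℤ) := by
      rw [Prime.dvd_finsetProd_iff Int.prime_two]
      rintro ⟨i, hi, hdvd⟩
      have := hQ4 i (hm hi)
      omega
    refine isSquare_algebraMap_adicCompletion_two_of_res8 v hℓ2 hprod0 ?_ ?_
    · rw [show (∏ i ∈ m, (i : ℚ)) = ((∏ i ∈ m, (i : ℤ) : ℤ) : ℚ) by push_cast; rfl, padicValRat.of_int,
        padicValInt.eq_zero_of_not_dvd hodd]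
      exact ⟨0, rfl⟩
    · rw [show (∏ i ∈ m, (i : ℚ)) = ((∏ i ∈ m, (i : ℤ) : ℤ) : ℚ) by push_cast; rfl, res8_intCast hodd]
      -- all factors are `≡ i₀ (mod 8)`, there is an even number of them, and `i₀² ≡ 1 (mod 8)`
      have h8 : (((∏ i ∈ m, (i : ℤ) : ℤ)) : ZMod 8) = 1 := by
        rw [Int.cast_prod]
        simp only [Int.cast_natCast]
        rw [Finset.prod_congr rfl (fun i hi => (ZMod.natCast_eq_natCast_iff' i i₀ 8).mpr (hiso8 i (hm hi) i₀ (hm hi₀))),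
          Finset.prod_const, hs, ← two_mul, pow_mul]
        have hr : i₀ % 8 = 3 ∨ i₀ % 8 = 7 := by have := hQ4 i₀ (hm hi₀); omega
        have hsq : ((i₀ : ℕ) : ZMod 8) ^ 2 = 1 := by
          rw [← ZMod.natCast_mod i₀ 8]
          rcases hr with hr | hr <;> rw [hr] <;> decide
        rw [hsq, one_pow]
      exact h8
  · -- an odd place `ℓ ∈ S`: unit with residue bit `0`
    refine isSquare_algebraMap_adicCompletion_of_bits v rfl hℓ2 hprod0 ?_ ?_
    · rw [parityBit, hval]; rfl
    · rw [qrBit_prod _ m _ hm0]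
      have hconst : ∀ i ∈ m, qrBit (primesEquiv v : ℕ) (i : ℚ) = qrBit (primesEquiv v : ℕ) (i₀ : ℚ) := fun i hi =>
        qrBit_natCast_eq_of_isoClass S Q hQ hisoS hv hℓ2 (hm hi) (hm hi₀)
      rw [Finset.sum_congr rfl hconst, Finset.sum_const, nsmul_eq_mul, hs, ← two_mul, Nat.cast_mul,
        show ((2 : ℕ) : ZMod 2) = 0 by decide, zero_mul, zero_mul]

end IsoClass

end Summit.BirchSwinnertonDyer.BirchSwinnertonDyer.Theorems.GenusKolyvaginAtTwo.TorsionCellSEL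

end
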